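import Summits.HodgeConjecture.HodgeConjecture.Theorems.EndoscopicMiddleDegreeOrthogonalEnvelopedCentreDescent
import Summits.HodgeConjecture.HodgeConjecture.Theorems.EndoscopicMiddleDegreeOrthogonalEnvelopedRationalRelations
import Summits.HodgeConjecture.HodgeConjecture.Theorems.EndoscopicMiddleDegreeOrthogonalEnvelopedRationalFitting
import Summits.HodgeConjecture.HodgeConjecture.Theorems.EndoscopicMiddleDegreeOrthogonalEnvelopedRatSpannedInf
import Literature.AlgebraicGeometry.ShimuraVarieties.HeckeCorrespondenceAction
import Literature.AlgebraicGeometry.HodgeTheory.ComplexGysinCorrespondence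
import Literature.AlgebraicGeometry.HodgeTheory.ComplexGysinHodgeType
import Literature.AlgebraicGeometry.HodgeTheory.ComplexConjugationHolds
import Literature.AlgebraicGeometry.HodgeTheory.GysinBaseChange
import Literature.AlgebraicGeometry.HodgeTheory.HodgeFiltrationModelsReductionProofs
import Literature.AlgebraicGeometry.HodgeTheory.HodgeTypeConjugation
import Literature.AlgebraicGeometry.HodgeTheory.HodgeTypePullback
import Literature.AlgebraicGeometry.HodgeTheory.SupportedHodgeClassDescent
import Literature.AlgebraicGeometry.HodgeTheory.RationalClassesRingChange
import Literature.AlgebraicGeometry.HodgeTheory.SupportedClassesRationalProofs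
import Literature.AlgebraicGeometry.HodgeTheory.VanishingCohomologyNontrivialProofs
import Literature.AlgebraicTopology.SingularHomology.GysinMapSupportProofs
import Literature.AlgebraicTopology.SingularHomology.CohomologyRingChangeFunctoriality
import Literature.AlgebraicTopology.SingularHomology.IntegralClassRingChange
import Literature.NumberTheory.Transcendental.DeRhamTheoremMultiplicative

/-!
# The ℚ-descent lemma for ℚ-blocks of the Hecke algebra and the strong sieve
# (crux `EndoscopicMiddleDegree.OrthogonalEnveloped`, stmt-HodgeConjecture-14300; line `middle-involution-purity`,
# second lead lineage; closes the registered stub `stub_sieveKillOfHodgeStable`)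

For a compact ball quotient `X` with datum `D : UnitaryBallQuotientDatum p X` let
`𝓗 = Algebra.adjoin ℂ (range (D.heckeCorrespondenceAction k))` be the Hecke algebra on
`H = Hᵏ(X(ℂ); ℂ)` (`X` smooth projective). Two ingredients:

* `typeKill` — DIRECTNESS OF THE HODGE DECOMPOSITION: an operator `z` preserving the type `(n,n)`
  whose image is spanned by classes of finitely many Hodge types all `≠ (n,n)` kills every class of
  type `(n,n)` (the pieces `H^{p,q}`, `p + q = 2n`, of a Hodge model are independent).
* `rationalBlockDescent` — THE ℚ-DESCENT LEMMA: for a ℚ-block `ε` of `𝓗` (central idempotent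
  preserving rational classes, primitive among such) and a non-zero central idempotent `z` of `𝓗` with
  `z ε = z`, if `z` kills a RATIONAL class `e` then `ε e = 0`. Proof: the centre of `𝓗` is ℚ-spanned
  (`descent_center`, landed file `…CentreDescent`, p100075); the coefficient vector of `z` on
  rational-preserving central elements is a combination of rational relations
  (`stub_rationalRelations`, p98208), so `z` lies in the span of rational-preserving central `j` with
  `j ε = j`, `j (ε e) = 0`; not all of them are nilpotent (`z` is a non-zero idempotent), and the
  rational Fitting idempotent of a non-nilpotent one (`stub_rationalFitting`, p98206) is a non-zero
  rational-preserving central idempotent below `ε` killing `ε e`; primitivity of `ε` forces it to be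
  `ε`. No `Aut(ℂ)`-orbit argument is used.

MAIN RESULT `stub_sieveKillOfHodgeStable` (registered stub of the line, byte-identical): granted that
`𝓗` preserves the type `(n,n)`, ONE ℂ-block `z ≤ ε` whose image avoids the type `(n,n)` makes the
ℚ-block `ε` kill every rational `(n,n)`-class (`typeKill` + `rationalBlockDescent`).

## References
* [BergeronMillsonMoeglin2016Balls] N. Bergeron, J. Millson, C. Moeglin, arXiv:1306.1515, Part 2 §1.9 (Hecke
  operators act on `Hᵏ(S(Γ); ℚ)`; ℚ-Hecke-isotypic pieces) and Thm 61.
* [VoisinHodgeI2002] C. Voisin, Hodge Theory and Complex Algebraic Geometry I, Thm. 6.18, Cor. 6.14, §7.1.1.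
-/

noncomputable section

-- The line namespace `Summit.<P>.<Sub>.Cruxes.…` repeats `HodgeConjecture` (single-conjunct summit).
set_option linter.dupNamespace false

namespace Summit.HodgeConjecture.HodgeConjecture.Cruxes.OrthogonalEnveloped.MiddleInvolutionPurity

open scoped BigOperators
open CategoryTheory
open Literature.AlgebraicGeometry.Motives (SchemeOver ComplexPoints IsSmoothProjective)
open Literature.AlgebraicGeometry.HodgeTheory
open Literature.AlgebraicGeometry.ShimuraVarieties
open Literature.AlgebraicTopology.SingularHomology

/-! ## R2 — the sieve DERIVED: Hodge directness + the ℚ-descent lemma -/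

/-- The pieces `H^{p,q}`, `p + q = k`, of a Hodge model are independent in `Hᵏ(X^an; ℂ)` (field
`isInternal_hodgePQ`, transported along the de Rham comparison). [cite: VoisinHodgeI2002, Thm. 6.18 and Cor. 6.14] -/
theorem typeKill_iSupIndep_hodgePQ {n : ℕ} {X : SchemeOver ℂ} (A : HodgeModel n X) (k : ℕ) :
    iSupIndep fun pq : ↥(Finset.HasAntidiagonal.antidiagonal k) ↦ A.hodgePQ k pq.1.1 pq.1.2 :=
  (iSupIndep_map_orderIso_iff (Submodule.orderIsoMapComap (A.deRham A.carrier k))).2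
    (A.isInternal_hodgePQ k).submodule_iSupIndep

/-- In a Hodge model, `H^{p,q} ⊆ Hᵏ` is `⊥` unless `p + q = k`. [folklore] -/
theorem typeKill_hodgePQ_eq_bot_of_ne {n : ℕ} {X : SchemeOver ℂ} (A : HodgeModel n X) {k p q : ℕ}
    (h : p + q ≠ k) : A.hodgePQ k p q = ⊥ := by
  rw [HodgeModel.hodgePQ, Literature.NumberTheory.Transcendental.hodgePQ_eq_bot_of_ne (M := A.carrier) h,
    Submodule.map_bot]

/-- **Directness of the Hodge decomposition kills the `(n,n)`-part of a type-avoiding piece.** If `z`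
preserves the type `(n,n)` and its image is spanned by classes of finitely many types all `≠ (n,n)`,
then `z` kills EVERY class of type `(n,n)` (read all types in one Hodge model `A`,
`hodgePQ_independent_of_hodgeModel_holds.isOfHodgeType_iff`; the pieces `H^{p,q}`, `p + q = 2n`, are
independent, `HodgeModel.isInternal_hodgePQ`; types of the wrong degree are `⊥`).
[cite: VoisinHodgeI2002, Thm. 6.18 and Cor. 6.14] -/
theorem typeKill {m : ℕ} {X : SchemeOver ℂ} (hX : IsSmoothProjective (2 * (m + 1)) X)
    {z : Module.End ℂ (complexBetti X (2 * (m + 1)))}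
    (hz : ∀ c, IsOfHodgeType (2 * (m + 1)) X (2 * (m + 1)) (m + 1) (m + 1) c →
      IsOfHodgeType (2 * (m + 1)) X (2 * (m + 1)) (m + 1) (m + 1) (z c))
    (hT : ∃ T : Finset (ℕ × ℕ), (m + 1, m + 1) ∉ T ∧
      LinearMap.range z ≤ Submodule.span ℂ {c : complexBetti X (2 * (m + 1)) |
        ∃ pq ∈ T, IsOfHodgeType (2 * (m + 1)) X (2 * (m + 1)) pq.1 pq.2 c})
    {c : complexBetti X (2 * (m + 1))} (hc : IsOfHodgeType (2 * (m + 1)) X (2 * (m + 1)) (m + 1) (m + 1) c) :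
    z c = 0 := by
  classical
  obtain ⟨T, hnn, hrange⟩ := hT
  obtain ⟨A, hA⟩ := hc
  have hI := hodgePQ_independent_of_hodgeModel_holds
  have h1 : A.pullback (2 * (m + 1)) (z c) ∈ A.hodgePQ (2 * (m + 1)) (m + 1) (m + 1) :=
    (hI.isOfHodgeType_iff hX A).1 (hz c ⟨A, hA⟩)
  let i0 : ↥(Finset.HasAntidiagonal.antidiagonal (2 * (m + 1))) :=
    ⟨(m + 1, m + 1), Finset.HasAntidiagonal.mem_antidiagonal.2 (two_mul (m + 1)).symm⟩
  have h2 : A.pullback (2 * (m + 1)) (z c) ∈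
      ⨆ (j : ↥(Finset.HasAntidiagonal.antidiagonal (2 * (m + 1)))) (_ : j ≠ i0), A.hodgePQ (2 * (m + 1)) j.1.1 j.1.2 := by
    have key : Submodule.span ℂ {c : complexBetti X (2 * (m + 1)) |
          ∃ pq ∈ T, IsOfHodgeType (2 * (m + 1)) X (2 * (m + 1)) pq.1 pq.2 c} ≤
        (⨆ (j : ↥(Finset.HasAntidiagonal.antidiagonal (2 * (m + 1)))) (_ : j ≠ i0),
          A.hodgePQ (2 * (m + 1)) j.1.1 j.1.2).comap (A.pullback (2 * (m + 1))).hom := by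
      refine Submodule.span_le.2 ?_
      rintro c' ⟨pq, hpq, hc'⟩
      have hc'' : A.pullback (2 * (m + 1)) c' ∈ A.hodgePQ (2 * (m + 1)) pq.1 pq.2 :=
        (hI.isOfHodgeType_iff hX A).1 hc'
      rw [SetLike.mem_coe, Submodule.mem_comap]
      by_cases hdeg : pq.1 + pq.2 = 2 * (m + 1)
      · have hj : (⟨pq, Finset.HasAntidiagonal.mem_antidiagonal.2 hdeg⟩ : ↥(Finset.HasAntidiagonal.antidiagonal (2 * (m + 1)))) ≠ i0 := by
          intro h
          apply hnn
          have h' : pq = (m + 1, m + 1) := congrArg Subtype.val h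
          rw [← h']
          exact hpq
        exact (le_iSup₂_of_le (f := fun (j : ↥(Finset.HasAntidiagonal.antidiagonal (2 * (m + 1)))) (_ : j ≠ i0) ↦
          A.hodgePQ (2 * (m + 1)) j.1.1 j.1.2) ⟨pq, Finset.HasAntidiagonal.mem_antidiagonal.2 hdeg⟩ hj le_rfl) hc''
      · rw [typeKill_hodgePQ_eq_bot_of_ne A hdeg, Submodule.mem_bot] at hc''
        change (A.pullback (2 * (m + 1))) c' ∈ _
        rw [hc'']
        exact Submodule.zero_mem _
    exact key (hrange (LinearMap.mem_range_self z c))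
  have hdisj := (typeKill_iSupIndep_hodgePQ A (2 * (m + 1))) i0
  rw [Submodule.disjoint_def] at hdisj
  have h0 : A.pullback (2 * (m + 1)) (z c) = 0 := hdisj _ h1 h2
  exact A.pullback_injective (2 * (m + 1)) (by rw [h0, map_zero])


/-! ## The ℚ-descent lemma (the helpers `descent_rp_sum_smul`, …, `descent_center` are the landed
file `…CentreDescent`; `stub_rationalRelations`, `stub_ratSpannedInf`, `stub_rationalFitting` are the
landed files `…RationalRelations`, `…RatSpannedInf`, `…RationalFitting`) -/

section Descent

variable {k : ℕ} {X : SchemeOver ℂ}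

/-! ### S2–S4 — the ℚ-descent lemma -/

/-- Powers of a rational-preserving operator are rational-preserving. [folklore] -/
theorem descent_rp_pow {j : Module.End ℂ (complexBetti X k)}
    (hj : ∀ β, IsRationalClass β → IsRationalClass (j β)) :
    ∀ (i : ℕ) β, IsRationalClass β → IsRationalClass ((j ^ i) β)
  | 0, β, hβ => by simpa using hβ
  | i + 1, β, hβ => by
    rw [pow_succ, Module.End.mul_apply]
    exact descent_rp_pow hj i _ (hj β hβ)

/-- A ℚ-polynomial in a rational-preserving operator is rational-preserving. [folklore] -/
theorem descent_rp_aeval {j : Module.End ℂ (complexBetti X k)}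
    (hj : ∀ β, IsRationalClass β → IsRationalClass (j β)) (P : Polynomial ℚ) :
    ∀ β, IsRationalClass β → IsRationalClass (Polynomial.aeval j (P.map (algebraMap ℚ ℂ)) β) := by
  intro β hβ
  rw [Polynomial.aeval_eq_sum_range, LinearMap.sum_apply]
  have h : ∀ i ∈ Finset.range ((P.map (algebraMap ℚ ℂ)).natDegree + 1),
      ((P.map (algebraMap ℚ ℂ)).coeff i • j ^ i) β = ((P.coeff i : ℚ) : ℂ) • (j ^ i) β := by
    intro i _
    rw [LinearMap.smul_apply, Polynomial.coeff_map]
    rfl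
  rw [Finset.sum_congr rfl h]
  exact IsRationalClass.sum_smul _ (fun i ↦ descent_rp_pow hj i β hβ) _

/-- A polynomial in `j` lies in every subalgebra containing `j`. [folklore] -/
theorem descent_aeval_mem {A : Subalgebra ℂ (Module.End ℂ (complexBetti X k))}
    {j : Module.End ℂ (complexBetti X k)} (hj : j ∈ A) (P : Polynomial ℂ) :
    Polynomial.aeval j P ∈ A := by
  rw [Polynomial.aeval_eq_sum_range]
  exact Subalgebra.sum_mem _ fun i _ ↦ Subalgebra.smul_mem _ (Subalgebra.pow_mem _ hj i) _

/-- Anything commuting with `j` commutes with every polynomial in `j`. [folklore] -/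
theorem descent_commute_aeval {T j : Module.End ℂ (complexBetti X k)} (h : T * j = j * T)
    (P : Polynomial ℂ) : T * Polynomial.aeval j P = Polynomial.aeval j P * T := by
  have hc : Commute T j := h
  rw [Polynomial.aeval_eq_sum_range, Finset.mul_sum, Finset.sum_mul]
  refine Finset.sum_congr rfl fun i _ ↦ ?_
  rw [mul_smul_comm, smul_mul_assoc, (hc.pow_right i).eq]

/-- **THE ℚ-DESCENT LEMMA for ℚ-blocks of the Hecke algebra.** Let `𝓗 = Algebra.adjoin ℂ (range T_g)`
on `H = Hᵏ(X(ℂ); ℂ)` (`X` smooth projective), `ε` a ℚ-BLOCK (central idempotent of `𝓗` preserving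
rational classes, primitive among the rational-preserving central idempotents) and `z` a central
idempotent of `𝓗` with `z ε = z`, `z ≠ 0`. If `z` kills a RATIONAL class `e`, then `ε e = 0`.
Proof: (S1) the centre of `𝓗` is ℚ-spanned (`descent_center`); (S2–S3) writing `z = Σ cᵢ rᵢ ε` with
`rᵢ` rational-preserving central and using `z (ε e) = 0`, the coefficient vector is a combination of
rational relations among the rational classes `rᵢ ε (ε e)` (`stub_rationalRelations`), so `z` lies in
the ℂ-span of `J = {j rational-preserving central, j ε = j, j (ε e) = 0}`; (S4) `J` is not nil (a
commuting family of nilpotents spans only nilpotents, and `z` is a non-zero idempotent), so some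
`j ∈ J` is not nilpotent and `stub_rationalFitting` gives a non-zero idempotent `f = p(j) j`: it is
central, rational-preserving, `f ε = f`, `f (ε e) = 0`; primitivity of `ε` forces `f = ε`, whence
`ε e = 0`. No `Aut(ℂ)`-orbit argument is used. [cite: BergeronMillsonMoeglin2016Balls, Part 2 §1.9] -/
theorem rationalBlockDescent {n : ℕ} (hX : IsSmoothProjective n X)
    {p : ℕ} (D : UnitaryBallQuotientDatum p X)
    {ε : Module.End ℂ (complexBetti X k)}
    (h1 : ε ∈ Algebra.adjoin ℂ (Set.range (D.heckeCorrespondenceAction k)))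
    (h2 : ε * ε = ε)
    (h3 : ∀ T ∈ Algebra.adjoin ℂ (Set.range (D.heckeCorrespondenceAction k)), T * ε = ε * T)
    (h4 : ∀ β, IsRationalClass β → IsRationalClass (ε β))
    (h5 : ∀ f ∈ Algebra.adjoin ℂ (Set.range (D.heckeCorrespondenceAction k)), f * f = f →
      (∀ T ∈ Algebra.adjoin ℂ (Set.range (D.heckeCorrespondenceAction k)), T * f = f * T) →
      (∀ β, IsRationalClass β → IsRationalClass (f β)) → f * ε = 0 ∨ f * ε = ε)
    {z : Module.End ℂ (complexBetti X k)}
    (hz1 : z ∈ Algebra.adjoin ℂ (Set.range (D.heckeCorrespondenceAction k)))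
    (hz2 : z * z = z)
    (hz3 : ∀ T ∈ Algebra.adjoin ℂ (Set.range (D.heckeCorrespondenceAction k)), T * z = z * T)
    (hz0 : z ≠ 0) (hzε : z * ε = z)
    {e : complexBetti X k} (he : IsRationalClass e) (hze : z e = 0) : ε e = 0 := by
  classical
  set 𝓐 := Algebra.adjoin ℂ (Set.range (D.heckeCorrespondenceAction k)) with h𝓐
  -- S0: replace `e` by `e' := ε e`
  set e' := ε e with he'def
  have he' : IsRationalClass e' := h4 e he
  have hze' : z e' = 0 := by
    rw [he'def, ← Module.End.mul_apply, hzε, hze]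
  have hεe' : ε e' = e' := by
    rw [he'def, ← Module.End.mul_apply, h2]
  -- S1: `z = Σ cz i • r i` with `r i` rational-preserving central; replace `r i` by `r i * ε`
  obtain ⟨I, r, cz, hrA, hrc, hrrp, hzsum⟩ := descent_center (k := k) hX D hz1 hz3
  let r' : Fin I → Module.End ℂ (complexBetti X k) := fun i ↦ r i * ε
  have hr'A : ∀ i, r' i ∈ 𝓐 := fun i ↦ Subalgebra.mul_mem _ (hrA i) h1
  have hr'c : ∀ i, ∀ T ∈ 𝓐, T * r' i = r' i * T := fun i T hT ↦ by
    change T * (r i * ε) = r i * ε * T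
    rw [← mul_assoc, hrc i T hT, mul_assoc, h3 T hT, mul_assoc]
  have hr'rp : ∀ i, ∀ β, IsRationalClass β → IsRationalClass (r' i β) :=
    fun i ↦ descent_rp_mul (hrrp i) h4
  have hr'ε : ∀ i, r' i * ε = r' i := fun i ↦ by
    change r i * ε * ε = r i * ε
    rw [mul_assoc, h2]
  have hzsum' : z = ∑ i, cz i • r' i := by
    rw [← hzε, hzsum, Finset.sum_mul]
    refine Finset.sum_congr rfl fun i _ ↦ ?_
    rw [smul_mul_assoc]
  -- S2–S3: `z` is a combination of rational-preserving central `j` with `j ε = j`, `j e' = 0`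
  have hrel : ∑ i, cz i • (r' i e') = 0 := by
    have h := congrArg (fun T : Module.End ℂ (complexBetti X k) ↦ T e') hzsum'
    simp only [LinearMap.sum_apply, LinearMap.smul_apply] at h
    rw [← h, hze']
  have hmem := stub_rationalRelations X k I (fun i ↦ r' i e') (fun i ↦ hr'rp i _ he') cz hrel
  rw [Submodule.mem_span_set'] at hmem
  obtain ⟨L, lam, g, hsum⟩ := hmem
  have hg : ∀ l, (∃ q : Fin I → ℚ, (g l : Fin I → ℂ) = fun i ↦ (q i : ℂ)) ∧
      ∑ i, (g l : Fin I → ℂ) i • r' i e' = 0 := fun l ↦ (g l).2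
  choose q hq using fun l ↦ (hg l).1
  let jj : Fin L → Module.End ℂ (complexBetti X k) := fun l ↦ ∑ i, ((q l i : ℚ) : ℂ) • r' i
  have hjjA : ∀ l, jj l ∈ 𝓐 := fun l ↦
    Subalgebra.sum_mem _ fun i _ ↦ Subalgebra.smul_mem _ (hr'A i) _
  have hjjc : ∀ l, ∀ T ∈ 𝓐, T * jj l = jj l * T := fun l T hT ↦ by
    change T * (∑ i, ((q l i : ℚ) : ℂ) • r' i) = (∑ i, ((q l i : ℚ) : ℂ) • r' i) * T
    rw [Finset.mul_sum, Finset.sum_mul]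
    refine Finset.sum_congr rfl fun i _ ↦ ?_
    rw [mul_smul_comm, smul_mul_assoc, hr'c i T hT]
  have hjjrp : ∀ l, ∀ β, IsRationalClass β → IsRationalClass (jj l β) :=
    fun l ↦ descent_rp_sum_smul _ (fun i ↦ hr'rp i) (q l)
  have hjjε : ∀ l, jj l * ε = jj l := fun l ↦ by
    change (∑ i, ((q l i : ℚ) : ℂ) • r' i) * ε = ∑ i, ((q l i : ℚ) : ℂ) • r' i
    rw [Finset.sum_mul]
    refine Finset.sum_congr rfl fun i _ ↦ ?_
    rw [smul_mul_assoc, hr'ε i]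
  have hjje' : ∀ l, jj l e' = 0 := fun l ↦ by
    have h := (hg l).2
    rw [hq l] at h
    change (∑ i, ((q l i : ℚ) : ℂ) • r' i) e' = 0
    simpa only [LinearMap.sum_apply, LinearMap.smul_apply] using h
  have hzjj : z = ∑ l, lam l • jj l := by
    have hca : ∀ i, cz i = ∑ l, lam l * ((q l i : ℚ) : ℂ) := by
      intro i
      have h := congrArg (fun f : Fin I → ℂ ↦ f i) hsum
      simp only [Finset.sum_apply, Pi.smul_apply, smul_eq_mul] at h
      rw [← h]
      refine Finset.sum_congr rfl fun l _ ↦ ?_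
      rw [hq l]
    rw [hzsum']
    simp_rw [hca, Finset.sum_smul, mul_smul]
    rw [Finset.sum_comm]
    refine Finset.sum_congr rfl fun l _ ↦ ?_
    rw [← Finset.smul_sum]
  -- S4: some `jj l` is not nilpotent
  have hex : ∃ l, ¬ IsNilpotent (jj l) := by
    by_contra hall
    push Not at hall
    have hcomm : ∀ l l', Commute (lam l • jj l) (lam l' • jj l') := fun l l' ↦ by
      refine (Commute.smul_right ?_ _).smul_left _
      exact (hjjc l' (jj l) (hjjA l))
    have hnil : IsNilpotent z := by
      rw [hzjj]
      exact Commute.isNilpotent_sum (fun l _ ↦ (hall l).smul (lam l)) fun l l' _ _ ↦ hcomm l l'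
    exact hz0 (IsIdempotentElem.eq_zero_of_isNilpotent hz2 hnil)
  obtain ⟨l, hl⟩ := hex
  -- the rational Fitting idempotent of `jj l`
  obtain ⟨P, hfid, hf0⟩ := stub_rationalFitting n X hX k (jj l) (hjjrp l) hl
  set f := Polynomial.aeval (jj l) ((Polynomial.X * P).map (algebraMap ℚ ℂ)) with hfdef
  set gP := Polynomial.aeval (jj l) (P.map (algebraMap ℚ ℂ)) with hgPdef
  have hfg : f = gP * jj l := by
    rw [hfdef, hgPdef, mul_comm Polynomial.X P, Polynomial.map_mul, Polynomial.map_X,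
      Polynomial.aeval_mul, Polynomial.aeval_X]
  have hfA : f ∈ 𝓐 := descent_aeval_mem (hjjA l) _
  have hfc : ∀ T ∈ 𝓐, T * f = f * T := fun T hT ↦ descent_commute_aeval (hjjc l T hT) _
  have hfrp : ∀ β, IsRationalClass β → IsRationalClass (f β) := descent_rp_aeval (hjjrp l) _
  have hfε : f * ε = f := by rw [hfg, mul_assoc, hjjε l]
  have hfe' : f e' = 0 := by rw [hfg, Module.End.mul_apply, hjje' l, map_zero]
  -- primitivity of `ε`
  rcases h5 f hfA hfid.eq hfc hfrp with h0 | hε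
  · exact absurd (hfε.symm.trans h0) hf0
  · -- `f = ε`, so `ε e' = 0`, i.e. `ε e = 0`
    have hfε' : f = ε := hfε.symm.trans hε
    rw [← hεe', ← hfε', hfe']
end Descent


/-- **Stub 4 (NEW, lead reshape R2; registered; PROVED here from Stubs 4a–4c) — THE STRONG SIEVE
GRANTED HODGE-TYPE STABILITY.** The planner's `stub_sieveKill` with the single extra hypothesis `hH`
(the Hecke algebra preserves the type `(n,n)`; in the line it is `heckeHodgeType`, from Stub 1): for a
ℚ-block `ε`, ONE ℂ-block `z ≤ ε` whose image avoids the type `(n,n)` makes `ε` kill every rational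
`(n,n)`-class. Strictly more than the sibling line's `stub_killedBarren` (which asks a killed conjugate
of EVERY ℂ-block below `ε`): the difference is the ℚ-descent lemma `rationalBlockDescent`.
[cite: BergeronMillsonMoeglin2016Balls, Part 2 §1.9 and Thm 61] -/
theorem stub_sieveKillOfHodgeStable :
    ∀ (m : ℕ) (X : SchemeOver ℂ) (D : UnitaryBallQuotientDatum (2 * (m + 1)) X), 1 ≤ m → m ≤ 2 →
      (∀ a ∈ Algebra.adjoin ℂ (Set.range (D.heckeCorrespondenceAction (2 * (m + 1)))),
        ∀ c : complexBetti X (2 * (m + 1)),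
          IsOfHodgeType (2 * (m + 1)) X (2 * (m + 1)) (m + 1) (m + 1) c →
            IsOfHodgeType (2 * (m + 1)) X (2 * (m + 1)) (m + 1) (m + 1) (a c)) →
      ∀ ε : Module.End ℂ (complexBetti X (2 * (m + 1))),
        ε ∈ Algebra.adjoin ℂ (Set.range (D.heckeCorrespondenceAction (2 * (m + 1)))) →
        ε * ε = ε →
        (∀ T ∈ Algebra.adjoin ℂ (Set.range (D.heckeCorrespondenceAction (2 * (m + 1)))), T * ε = ε * T) →
        (∀ β, IsRationalClass β → IsRationalClass (ε β)) →
        (∀ f ∈ Algebra.adjoin ℂ (Set.range (D.heckeCorrespondenceAction (2 * (m + 1)))), f * f = f →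
          (∀ T ∈ Algebra.adjoin ℂ (Set.range (D.heckeCorrespondenceAction (2 * (m + 1)))), T * f = f * T) →
          (∀ β, IsRationalClass β → IsRationalClass (f β)) → f * ε = 0 ∨ f * ε = ε) →
        ∀ z : Module.End ℂ (complexBetti X (2 * (m + 1))),
          z ∈ Algebra.adjoin ℂ (Set.range (D.heckeCorrespondenceAction (2 * (m + 1)))) →
          z * z = z →
          (∀ T ∈ Algebra.adjoin ℂ (Set.range (D.heckeCorrespondenceAction (2 * (m + 1)))), T * z = z * T) →
          z ≠ 0 →
          (∀ f ∈ Algebra.adjoin ℂ (Set.range (D.heckeCorrespondenceAction (2 * (m + 1)))), f * f = f →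
            (∀ T ∈ Algebra.adjoin ℂ (Set.range (D.heckeCorrespondenceAction (2 * (m + 1)))), T * f = f * T) →
            f * z = 0 ∨ f * z = z) →
          z * ε = z →
          (∃ T : Finset (ℕ × ℕ), (m + 1, m + 1) ∉ T ∧
            LinearMap.range z ≤ Submodule.span ℂ {c : complexBetti X (2 * (m + 1)) |
              ∃ pq ∈ T, IsOfHodgeType (2 * (m + 1)) X (2 * (m + 1)) pq.1 pq.2 c}) →
          ∀ e : complexBetti X (2 * (m + 1)), IsRationalClass e →
            IsOfHodgeType (2 * (m + 1)) X (2 * (m + 1)) (m + 1) (m + 1) e → ε e = 0 :=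
  fun _ _ D _ _ hH _ h1 h2 h3 h4 h5 _ hz1 hz2 hz3 hz0 _ hzε hT _ he he' ↦
    rationalBlockDescent D.isSmoothProjective D h1 h2 h3 h4 h5 hz1 hz2 hz3 hz0 hzε he
      (typeKill D.isSmoothProjective (hH _ hz1) hT he')

end Summit.HodgeConjecture.HodgeConjecture.Cruxes.OrthogonalEnveloped.MiddleInvolutionPurity

end
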